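import Literature.AlgebraicGeometry.Motives.FaltingsECTateFiniteEndProofs
import Literature.AlgebraicGeometry.Motives.FaltingsECTateMainTheoremProofs
import Literature.AlgebraicGeometry.Motives.FaltingsECTateFrobeniusScalarProofs
import Literature.AlgebraicGeometry.Motives.FaltingsECTateNoncommutativeProofs
import Literature.NumberTheory.EllipticCurves.IsogenyTwoPowerQuotientProofs
import Literature.NumberTheory.EllipticCurves.FrobeniusScalarCharTwoProofs
import HarnessLib

/-!
# Tate's isogeny theorem (`End` form) for elliptic curves over finite fields: the discharge

Sibling file of `Literature.AlgebraicGeometry.Motives.FaltingsEC` (D-0014; theorems only),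
discharging the named fact

* `Literature.Hodge.mem_span_range_tateEndRingHom_iff_of_finite W ℓ` —
  **Tate, Invent. Math. 2 (1966), Main Theorem, in `End` form for an elliptic curve over a finite
  field**: for `E` elliptic over a finite field `k` and a prime `ℓ ≠ char k`, a `ℤ_ℓ`-linear
  endomorphism of `T_ℓ E` lies in the `ℤ_ℓ`-span of the image of `End_k(E)` iff it commutes with
  `Γ_k = Gal(k̄/k)` (Silverman, *AEC*, Thm. III.7.7(a) for `E₁ = E₂`: `End_k(E) ⊗ ℤ_ℓ ≅
  End_{Γ_k}(T_ℓ E)`; the injectivity half being `linearIndependent_tateModule_map`) —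

as `Literature.AlgebraicGeometry.Motives.mem_span_range_tateEndRingHom_iff_of_finite_holds`, by assembling the tree's
two cases according to the action of the arithmetic Frobenius `σ_q` on `T_ℓ E`:

* **`σ_q` not an `ℓ`-adic scalar** (all ordinary curves, and the supersingular ones with `π ∉ ℤ`):
  the commutant of `T_ℓ(π)` in `End(T_ℓ E)` is `ℚ_ℓ[π] ∩ End(T_ℓ E)`, Tate's dimension count —
  `FaltingsECTateFiniteProofs`, `FaltingsECTateFiniteEndProofs` (with *AEC* III.§4 and
  Cor. III.4.11, both theorems of the tree);
* **`σ_q = c ∈ ℤ_ℓ` on `T_ℓ E`** (the central case; Waterhouse, Ann. Sci. ÉNS 2 (1969), Thm. 4.1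
  (2): supersingular with all endomorphisms defined over `k`): then `σ_q` acts on the whole of
  `E(k̄)` as an integer `m` (`FaltingsECTateFrobeniusScalarProofs`, by counting the points of
  `ker(π - m)` with division polynomials); hence `End_k(E)` is **not commutative** — in odd
  characteristic by Tate's own §2 run at the prime `2` with the cyclic `2`-power quotients built
  from Silverman's explicit `2`-isogeny (`IsogenyTwoPowerQuotientProofs` and the first part of
  this file), in characteristic `2` by two non-commuting automorphisms of the `j = 0` curve
  (`FrobeniusScalarCharTwoProofs`); and a non-commutative `End_k(E)` has
  `ℚ_ℓ · End_k(E) = End(V_ℓ E)` (`FaltingsECTateNoncommutativeProofs`), which with Tate's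
  Lemma 1 (saturation, the tree's `mem_span_range_tateEndRingHom_of_smul_mem`) is the claim.

## Part 1. The central case from cyclic quotient isogenies (Tate §2 with a weaker hypothesis)

The tree's `FaltingsECTateProp1Proofs` / `FaltingsECTateMainTheoremProofs` carry out Tate's §2
(Proposition 1: endomorphisms approximating every line of `T_ℓ E`; Proposition 2: density) from
the hypothesis `hquot` of quotient isogenies by **all** finite `Γ_k`-stable subgroups (the named
fact `WeierstrassCurve.exists_isogeny_ker_eq_and_comp_eq_nsmul`, not proved in the tree). Only
quotients by the **cyclic** groups `⟨v_n⟩ ⊆ E[ℓ^n]` are used there; Part 1 records the two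
statements with that weaker hypothesis, and draws the conclusion needed downstream —
**`End_k(E)` is not commutative** — which at `ℓ = 2` becomes unconditional by the `2`-isogeny
chains of `Literature.NumberTheory.EllipticCurves.IsogenyTwoPowerQuotientProofs`:

* `Literature.AlgebraicGeometry.Motives.exists_isogeny_tateModule_map_approx_of_forall`: Tate's Proposition 1
  (construction) for a primitive `v ∈ T_ℓ E`, from quotient isogenies `E → E/⟨v_n⟩ → E` given
  for all `n` (the tree's `exists_isogeny_tateModule_map_approx` with its first step detached);
* `Literature.AlgebraicGeometry.Motives.exists_isogeny_comp_ne_comp_of_smul_eq`: if `σ_q = c` on `T_ℓ E` and the cyclic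
  quotients exist for every primitive `v` with `Γ_k`-stable reductions, then two isogenies
  `E → E` over `k` do not commute (Tate, §2, proof of Proposition 2: the algebra generated by
  `End_k(E)` realises every line of `ℤ_ℓ²` as an image, so it is not commutative — the tree's
  `Literature.AlgebraicGeometry.Motives.FinTwo.exists_mul_ne_mul_of_forall_exists_range_le`);
* `Literature.AlgebraicGeometry.Motives.exists_endRing_mul_ne_mul_of_frobenius_smul_eq_zsmul`: for `k` of **odd**
  characteristic and `E / k` elliptic whose Frobenius acts on `E(k̄)` as an integer `m`
  (the output of `FaltingsECTateFrobeniusScalarProofs` in the central case), `End_k(E)` is not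
  commutative — unconditionally, the cyclic `2`-power quotients being supplied by
  `WeierstrassCurve.exists_isogeny_ker_eq_zmultiples_of_addOrderOf_eq_two_pow`.

## Part 2. The discharge, and the `Hom` form

* `Literature.AlgebraicGeometry.Motives.exists_endRing_mul_ne_mul_of_smul_eq`, `…exists_pow_smul_mem_span_range_tateEndRingHom_of_smul_eq`:
  the central case in both characteristic parities, and Tate's theorem `⊗ ℚ_ℓ` there;
* `Literature.AlgebraicGeometry.Motives.mem_span_range_tateEndRingHom_iff_of_finite_holds`: **the discharge**;
* `Literature.AlgebraicGeometry.Motives.mem_span_range_tateModule_map_of_equivariant_of_finite_self`,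
  `…_of_isIsogenous`, `…_of_isogenous_fact`: the `Hom` form
  `mem_span_range_tateModule_map_of_equivariant_of_finite W W' ℓ` for `W' = W`, for isogenous
  `W, W'` (proved), and in general from Tate's isogeny theorem (Theorem 1(b)) alone.

## References

* [Tate1966Endomorphisms] J. Tate, *Endomorphisms of abelian varieties over finite fields*,
  Invent. Math. 2 (1966), 134–144, Main Theorem, §1 Lemma 1, §2 Propositions 1–2 and their proofs.
* [SilvermanAEC2009] J. H. Silverman, *The Arithmetic of Elliptic Curves*, 2nd ed., GTM 106,
  Thm. III.7.7(a), Thm. III.7.4, Prop. III.4.12, Rem. III.4.13.2, Thm. III.6.1–6.2, III.4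
  Example 4.5, Exercise 3.7, V.§3, Appendix A.
* [Waterhouse1969] W. C. Waterhouse, *Abelian varieties over finite fields*, Ann. Sci. ÉNS (4) 2
  (1969), Ch. 2 and Thm. 4.1 (the supersingular curves with all endomorphisms defined over `k`).
-/

noncomputable section

open scoped Classical

universe u

namespace Literature.AlgebraicGeometry.Motives

open WeierstrassCurve

variable {K : Type u} [Field K] {W : WeierstrassCurve K} (ℓ : ℕ) [Fact ℓ.Prime]

/-! ## Part 1. Tate's §2 from cyclic quotients

### Proposition 1 from cyclic quotients -/

/-- **Tate 1966, Proposition 1 for an elliptic curve over a finite field, from cyclic quotient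
isogenies** (the tree's `exists_isogeny_tateModule_map_approx` with the quotients supplied
directly): let `E` be elliptic over a finite field `k`, `ℓ` a prime, `v ∈ T_ℓ E`, and suppose that
for every `n` there are an elliptic curve `B_n / k` and isogenies `g_n : E → B_n`,
`f_n : B_n → E` over `k` with `ker g_n = ⟨v_n⟩`, `f_n g_n = [ℓ^n]`, `g_n f_n = [ℓ^n]`. Then there
is `n₀` such that for every `k` some endomorphism `φ` of `E` over `k` has
`T_ℓ(φ)(T_ℓ E) ⊆ ℤ_ℓ v + ℓ^k T_ℓ E` and takes the value `ℓ^{n₀} v` (`φ = f_m ∘ g_{n₀}` for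
`B_m = B_{n₀}`, which happens for infinitely many `m` since `k` carries finitely many Weierstrass
curves). Proof verbatim from the tree. Tate, Invent. Math. 2 (1966), §2, Proposition 1 and its
proof. [cite: Tate1966Endomorphisms, §2 Proposition 1] -/
theorem exists_isogeny_tateModule_map_approx_of_forall [Finite K] [W.IsElliptic]
    {v : W.tateModule ℓ}
    (hP : ∀ n : ℕ, ∃ (B : WeierstrassCurve K) (_ : B.IsElliptic) (g : Isogeny W B)
      (f : Isogeny B W), (∀ P, g P = 0 ↔ P ∈ AddSubgroup.zmultiples (Literature.NumberTheory.EllipticCurves.TateModule.proj ℓ n v)) ∧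
        (∀ P, f (g P) = ℓ ^ n • P) ∧ ∀ Q, g (f Q) = ℓ ^ n • Q) :
    ∃ n₀ : ℕ, ∀ k : ℕ, ∃ φ : Isogeny W W,
      (∃ x : W.tateModule ℓ, Literature.NumberTheory.EllipticCurves.TateModule.map ℓ φ.toAddMonoidHom x = (ℓ : ℤ_[ℓ]) ^ n₀ • v) ∧
      ∀ x : W.tateModule ℓ, ∃ (a : ℤ_[ℓ]) (z : W.tateModule ℓ),
        Literature.NumberTheory.EllipticCurves.TateModule.map ℓ φ.toAddMonoidHom x = a • v + (ℓ : ℤ_[ℓ]) ^ k • z := by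
  haveI : Finite (WeierstrassCurve K) := finite_weierstrassCurve
  choose Bf hBf using hP
  -- one curve `B` occurs for infinitely many `n`
  obtain ⟨B, hinf⟩ := Finite.exists_infinite_fiber Bf
  have hI : (Bf ⁻¹' {B}).Infinite := Set.infinite_coe_iff.mp hinf
  have hPB : ∀ n ∈ Bf ⁻¹' {B}, ∃ (_ : B.IsElliptic) (g : Isogeny W B) (f : Isogeny B W),
      (∀ P, g P = 0 ↔ P ∈ AddSubgroup.zmultiples (Literature.NumberTheory.EllipticCurves.TateModule.proj ℓ n v)) ∧
        (∀ P, f (g P) = ℓ ^ n • P) ∧ ∀ Q, g (f Q) = ℓ ^ n • Q := by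
    intro n hn
    have h := hBf n
    rw [show Bf n = B from hn] at h
    exact h
  obtain ⟨n₀, hn₀⟩ := hI.nonempty
  obtain ⟨_, g₀, f₀, -, -, hgf₀⟩ := hPB n₀ hn₀
  refine ⟨n₀, fun k ↦ ?_⟩
  obtain ⟨m, hmI, hkm⟩ := hI.exists_gt k
  obtain ⟨_, g, f, hker, hfg, hgf⟩ := hPB m hmI
  -- `φ = f_m ∘ g_{n₀}`
  have hTφ : ∀ x, Literature.NumberTheory.EllipticCurves.TateModule.map ℓ (f.comp g₀).toAddMonoidHom x =
      Literature.NumberTheory.EllipticCurves.TateModule.map ℓ f.toAddMonoidHom (Literature.NumberTheory.EllipticCurves.TateModule.map ℓ g₀.toAddMonoidHom x) := fun x ↦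
    Literature.NumberTheory.EllipticCurves.TateModule.ext fun j ↦ rfl
  refine ⟨f.comp g₀, ?_, fun x ↦ ?_⟩
  · -- the value `ℓ^{n₀} v = φ (f₀ y)` where `f_m y = v`
    obtain ⟨y, hy⟩ := exists_tateModule_map_eq_of_ker_eq ℓ hker hfg
    refine ⟨Literature.NumberTheory.EllipticCurves.TateModule.map ℓ f₀.toAddMonoidHom y, ?_⟩
    have h1 : Literature.NumberTheory.EllipticCurves.TateModule.map ℓ g₀.toAddMonoidHom (Literature.NumberTheory.EllipticCurves.TateModule.map ℓ f₀.toAddMonoidHom y) =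
        (ℓ : ℤ_[ℓ]) ^ n₀ • y := Literature.NumberTheory.EllipticCurves.TateModule.ext fun j ↦ by
      rw [Literature.NumberTheory.EllipticCurves.TateModule.proj_map, Literature.NumberTheory.EllipticCurves.TateModule.proj_map, Isogeny.coe_toAddMonoidHom,
        Isogeny.coe_toAddMonoidHom, hgf₀, Literature.NumberTheory.EllipticCurves.TateModule.proj_pow_smul]
    rw [hTφ, h1, map_smul, hy]
  · -- `φ(T) ⊆ f_m(T_ℓ B) ⊆ ℤ_ℓ v + ℓ^m T ⊆ ℤ_ℓ v + ℓ^k T`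
    obtain ⟨a, z, haz⟩ :=
      exists_tateModule_map_eq_add_of_ker_eq ℓ hker hgf (Literature.NumberTheory.EllipticCurves.TateModule.map ℓ g₀.toAddMonoidHom x)
    refine ⟨a, (ℓ : ℤ_[ℓ]) ^ (m - k) • z, ?_⟩
    rw [hTφ, haz, smul_smul, ← pow_add, Nat.add_sub_cancel' hkm.le]

/-! ## Non-commutativity of `End_k(E)` in the central case -/

/-- **Tate's theorem, central case, from cyclic quotients: `End_k(E)` is not commutative.** Let
`E` be an elliptic curve over a finite field `k`, `ℓ` a prime with `ℓ ≠ 0` in `k`, and suppose the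
arithmetic Frobenius `σ_q` acts on `T_ℓ E` as a scalar `c ∈ ℤ_ℓ` (so every cyclic subgroup
`⟨v_n⟩ ⊆ E[ℓ^n]` is `Γ_k`-stable, `smul_proj_mem_zmultiples`). Assume (`hquot`) that for every
primitive `v ∈ T_ℓ E` with `Γ_k`-stable reductions and every `n` there are an elliptic curve
`B / k` and isogenies `g : E → B`, `f : B → E` over `k` with `ker g = ⟨v_n⟩`, `f g = [ℓ^n]`,
`g f = [ℓ^n]`. Then there are isogenies `φ, ψ : E → E` over `k` with `φ ψ ≠ ψ φ`. Proof: as in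
the tree's `exists_pow_smul_mem_span_tateModule_map_of_equivariant_end` (scalar case, copied),
Proposition 1 and the compactness of `End(ℤ_ℓ²)` give for every line of `ℤ_ℓ²` a non-zero
element of the algebra `M` generated by the `T_ℓ φ` with image in that line; such an `M` is not
commutative (`Literature.AlgebraicGeometry.Motives.FinTwo.exists_mul_ne_mul_of_forall_exists_range_le`, Tate's proof of
Proposition 2), hence neither is the set of the `T_ℓ φ`, nor `End_k(E)`. Tate, Invent. Math. 2
(1966), §2, Propositions 1–2. [cite: Tate1966Endomorphisms, §2 Propositions 1–2] -/
theorem exists_isogeny_comp_ne_comp_of_smul_eq [Finite K] [W.IsElliptic]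
    (hℓ : (ℓ : K) ≠ 0) {σ : Field.absoluteGaloisGroup K}
    (hσ : ∀ x : AlgebraicClosure K, σ • x = x ^ Nat.card K) {c : ℤ_[ℓ]}
    (hπc : ∀ x : W.tateModule ℓ, σ • x = c • x)
    (hquot : ∀ v : W.tateModule ℓ, Literature.NumberTheory.EllipticCurves.TateModule.proj ℓ 1 v ≠ 0 →
      (∀ (n : ℕ) (τ : Field.absoluteGaloisGroup K),
        τ • Literature.NumberTheory.EllipticCurves.TateModule.proj ℓ n v ∈ AddSubgroup.zmultiples (Literature.NumberTheory.EllipticCurves.TateModule.proj ℓ n v)) →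
      ∀ n : ℕ, ∃ (B : WeierstrassCurve K) (_ : B.IsElliptic) (g : Isogeny W B) (f : Isogeny B W),
        (∀ P, g P = 0 ↔ P ∈ AddSubgroup.zmultiples (Literature.NumberTheory.EllipticCurves.TateModule.proj ℓ n v)) ∧
          (∀ P, f (g P) = ℓ ^ n • P) ∧ ∀ Q, g (f Q) = ℓ ^ n • Q) :
    ∃ φ ψ : Isogeny W W, φ.toAddMonoidHom.comp ψ.toAddMonoidHom ≠
      ψ.toAddMonoidHom.comp φ.toAddMonoidHom := by
  obtain ⟨e⟩ := nonempty_tateModule_linearEquiv W ℓ hℓ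
  -- the set `𝓡` of conjugated Tate-module maps of the elements of `Hom_k(E, E)`
  set 𝓡 : Set (Module.End ℤ_[ℓ] (Fin 2 → ℤ_[ℓ])) :=
    {u | ∃ g ∈ homModule W W, u = e.conj (Literature.NumberTheory.EllipticCurves.TateModule.map ℓ g)} with h𝓡
  have mem𝓡 : ∀ g ∈ homModule W W, e.conj (Literature.NumberTheory.EllipticCurves.TateModule.map ℓ g) ∈ 𝓡 := fun g hg ↦ ⟨g, hg, rfl⟩
  have hHom : ∀ g ∈ homModule W W, g = 0 ∨ ∃ φ : Isogeny W W, φ.toAddMonoidHom = g :=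
    fun g hg ↦ (mem_homModule_iff_holds W W g).mp hg
  have h𝓡mul : ∀ r ∈ 𝓡, ∀ s ∈ 𝓡, r * s ∈ 𝓡 := by
    rintro r ⟨g, hg, rfl⟩ s ⟨g', hg', rfl⟩
    have hcomp : g.comp g' ∈ homModule W W := by
      rcases hHom g hg with rfl | ⟨φ, rfl⟩
      · rw [AddMonoidHom.zero_comp]
        exact Submodule.zero_mem _
      rcases hHom g' hg' with rfl | ⟨ψ, rfl⟩
      · rw [AddMonoidHom.comp_zero]
        exact Submodule.zero_mem _
      · exact (φ.comp ψ).toAddMonoidHom_mem_homModule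
    refine ⟨g.comp g', hcomp, ?_⟩
    rw [Literature.NumberTheory.EllipticCurves.TateModule.map_comp, LinearEquiv.conj_comp, Module.End.mul_eq_comp]
  have h𝓡sub : ∀ r ∈ 𝓡, ∀ s ∈ 𝓡, r - s ∈ 𝓡 := by
    rintro r ⟨g, hg, rfl⟩ s ⟨g', hg', rfl⟩
    exact ⟨g - g', Submodule.sub_mem _ hg hg', by rw [Literature.NumberTheory.EllipticCurves.TateModule.map_sub, map_sub]⟩
  have h𝓡inj : ∀ r ∈ 𝓡, ∀ w : Fin 2 → ℤ_[ℓ], w ≠ 0 → r w = 0 → r = 0 := by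
    rintro r ⟨g, hg, rfl⟩ w hw hrw
    rcases hHom g hg with rfl | ⟨φ, rfl⟩
    · rw [Literature.NumberTheory.EllipticCurves.TateModule.map_zero, map_zero]
    · exfalso
      rw [LinearEquiv.conj_apply_apply, e.map_eq_zero_iff] at hrw
      have h0 : e.symm w = 0 :=
        tateModule_map_injective ℓ φ (hrw.trans (map_zero _).symm)
      rw [e.symm.map_eq_zero_iff] at h0
      exact hw h0
  have h1𝓡 : (1 : Module.End ℤ_[ℓ] (Fin 2 → ℤ_[ℓ])) ∈ 𝓡 := by
    refine ⟨(Isogeny.id W).toAddMonoidHom, (Isogeny.id W).toAddMonoidHom_mem_homModule, ?_⟩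
    rw [show Literature.NumberTheory.EllipticCurves.TateModule.map ℓ (Isogeny.id W).toAddMonoidHom = LinearMap.id from
      Literature.NumberTheory.EllipticCurves.TateModule.map_id, LinearEquiv.conj_id]
    rfl
  -- the subalgebra generated by `𝓡` is its span
  set M : Subalgebra ℤ_[ℓ] (Module.End ℤ_[ℓ] (Fin 2 → ℤ_[ℓ])) := Algebra.adjoin ℤ_[ℓ] 𝓡 with hM
  have hMspan : ∀ u ∈ M, u ∈ Submodule.span ℤ_[ℓ] 𝓡 := by
    intro u hu
    have hcl : ((Submonoid.closure 𝓡 : Submonoid (Module.End ℤ_[ℓ] (Fin 2 → ℤ_[ℓ]))) :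
        Set (Module.End ℤ_[ℓ] (Fin 2 → ℤ_[ℓ]))) = 𝓡 := by
      let T𝓡 : Submonoid (Module.End ℤ_[ℓ] (Fin 2 → ℤ_[ℓ])) :=
        { carrier := 𝓡
          mul_mem' := fun {a b} ha hb ↦ h𝓡mul a ha b hb
          one_mem' := h1𝓡 }
      exact congrArg SetLike.coe (Submonoid.closure_eq T𝓡)
    have hspan := Algebra.adjoin_eq_span (R := ℤ_[ℓ]) 𝓡
    rw [hcl] at hspan
    rw [hM, ← Subalgebra.mem_toSubmodule, hspan] at hu
    exact hu
  have h𝓡M : 𝓡 ⊆ M := Algebra.subset_adjoin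
  have hℓ0 : (ℓ : ℤ_[ℓ]) ≠ 0 := Nat.cast_ne_zero.mpr (Fact.out : ℓ.Prime).ne_zero
  -- **Proposition 1** for every line of `ℤ_ℓ²`
  have hP1 : ∀ v' : Fin 2 → ℤ_[ℓ], v' ≠ 0 → ∃ u ∈ M, u ≠ 0 ∧
      ∀ x, u x ∈ (ℤ_[ℓ] ∙ v' : Submodule ℤ_[ℓ] (Fin 2 → ℤ_[ℓ])) := by
    intro v' hv'
    -- the primitive part `v₀` of `v = e⁻¹ v' = ℓ ^ j • v₀`
    have hv : e.symm v' ≠ 0 := by rwa [e.symm.map_ne_zero_iff]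
    obtain ⟨j, v₀, hvj, hv₀⟩ := exists_eq_pow_smul_of_ne_zero ℓ hv
    have hv₀0 : v₀ ≠ 0 := by
      rintro rfl
      exact hv₀ (map_zero _)
    have hv'eq : v' = (ℓ : ℤ_[ℓ]) ^ j • e v₀ := by
      rw [← map_smul, ← hvj, LinearEquiv.apply_symm_apply]
    -- the construction (quotients `E/⟨v₀,n⟩` through finitely many curves)
    obtain ⟨n₀, happrox⟩ := exists_isogeny_tateModule_map_approx_of_forall ℓ
      (hquot v₀ hv₀ fun n τ ↦ smul_proj_mem_zmultiples ℓ hσ hπc v₀ n τ)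
    -- the compactness argument on `ℤ_ℓ²`
    obtain ⟨u, huN, hu0, hu⟩ := FinTwo.exists_ne_zero_forall_mem_span_of_approx
      (Submodule.span ℤ_[ℓ] 𝓡) (e v₀) (c := (ℓ : ℤ_[ℓ]) ^ n₀ • e v₀)
      (smul_ne_zero (pow_ne_zero _ hℓ0) (by rwa [e.map_ne_zero_iff])) (fun k ↦ by
        obtain ⟨φ, ⟨x, hx⟩, hφ⟩ := happrox k
        refine ⟨e.conj (Literature.NumberTheory.EllipticCurves.TateModule.map ℓ φ.toAddMonoidHom),
          Submodule.subset_span (mem𝓡 _ φ.toAddMonoidHom_mem_homModule), ⟨e x, ?_⟩,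
          fun x' ↦ ?_⟩
        · rw [LinearEquiv.conj_apply_apply, LinearEquiv.symm_apply_apply, hx, map_smul]
        · obtain ⟨a, z, haz⟩ := hφ (e.symm x')
          exact ⟨a, e z, by rw [LinearEquiv.conj_apply_apply, haz, map_add, map_smul, map_smul]⟩)
    refine ⟨(ℓ : ℤ_[ℓ]) ^ j • u, ?_, smul_ne_zero (pow_ne_zero _ hℓ0) hu0, fun x ↦ ?_⟩
    · exact M.smul_mem (Algebra.span_le_adjoin ℤ_[ℓ] 𝓡 huN) _
    · obtain ⟨a, ha⟩ := Submodule.mem_span_singleton.mp (hu x)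
      rw [LinearMap.smul_apply, ← ha, smul_smul, mul_comm, ← smul_smul, hv'eq]
      exact Submodule.smul_mem _ _ (Submodule.mem_span_singleton_self _)
  -- **Proposition 2, Step 1**: `M` is not commutative, hence neither is `𝓡`, i.e. `End_k(E)`
  obtain ⟨u, huM, u', hu'M, huu'⟩ := FinTwo.exists_mul_ne_mul_of_forall_exists_range_le M hP1
  have hnc : ¬ ∀ r ∈ 𝓡, ∀ s ∈ 𝓡, r * s = s * r := fun hcomm ↦
    huu' (FinTwo.mul_comm_of_mem_span hcomm (hMspan u huM) (hMspan u' hu'M))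
  push Not at hnc
  obtain ⟨_, ⟨g₁, hg₁, rfl⟩, _, ⟨g₂, hg₂, rfl⟩, hne⟩ := hnc
  rcases hHom g₁ hg₁ with rfl | ⟨φ, rfl⟩
  · exact absurd (by rw [Literature.NumberTheory.EllipticCurves.TateModule.map_zero, map_zero, zero_mul, mul_zero]) hne
  rcases hHom g₂ hg₂ with rfl | ⟨ψ, rfl⟩
  · exact absurd (by rw [Literature.NumberTheory.EllipticCurves.TateModule.map_zero, map_zero, zero_mul, mul_zero]) hne
  refine ⟨φ, ψ, fun h ↦ hne ?_⟩
  rw [Module.End.mul_eq_comp, Module.End.mul_eq_comp, ← LinearEquiv.conj_comp,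
    ← LinearEquiv.conj_comp, ← Literature.NumberTheory.EllipticCurves.TateModule.map_comp, ← Literature.NumberTheory.EllipticCurves.TateModule.map_comp, h]

/-! ## At `ℓ = 2`: unconditionally, in odd characteristic -/

variable (W) in
/-- **In odd characteristic, an elliptic curve over a finite field whose Frobenius acts on
`E(k̄)` as an integer has non-commutative `End_k(E)`.** Let `k` be finite with `2 ≠ 0` in `k`,
`σ_q` its arithmetic Frobenius, `E / k` elliptic, and suppose `σ_q P = m P` for all `P ∈ E(k̄)`
and some `m ∈ ℤ` (the central case of Tate's theorem: `E` supersingular with `π = m = ±√q`,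
Waterhouse, Ann. Sci. ÉNS 2 (1969), Thm. 4.1 (2)). Then `End_k(E)` contains two elements which do
not commute (so `End_k(E) ⊗ ℚ` is a quaternion algebra): `σ_q = m` on `T_2 E`, every cyclic
subgroup of `E[2^n]` is `Γ_k`-stable, and the quotients by them exist
(`exists_isogeny_ker_eq_zmultiples_of_addOrderOf_eq_two_pow`), so
`exists_isogeny_comp_ne_comp_of_smul_eq` applies at `ℓ = 2`. Tate, Invent. Math. 2 (1966), Main
Theorem and §2; Waterhouse (1969), Thm. 4.1. [cite: Tate1966Endomorphisms, Main Theorem and §2] -/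
theorem exists_endRing_mul_ne_mul_of_frobenius_smul_eq_zsmul [Finite K] [W.IsElliptic]
    (h2 : (2 : K) ≠ 0) {σ : Field.absoluteGaloisGroup K}
    (hσ : ∀ x : AlgebraicClosure K, σ • x = x ^ Nat.card K) {m : ℤ}
    (hm : ∀ P : W.geomPoints, σ • P = m • P) :
    ∃ a b : W.endRing, a * b ≠ b * a := by
  haveI : Fact (Nat.Prime 2) := ⟨Nat.prime_two⟩
  have h2' : ((2 : ℕ) : K) ≠ 0 := by exact_mod_cast h2
  -- the Frobenius is the scalar `m` on `T_2 E`
  have hπc : ∀ x : W.tateModule 2, σ • x = (m : ℤ_[2]) • x := fun x ↦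
    Literature.NumberTheory.EllipticCurves.TateModule.ext fun n ↦ by
      rw [Literature.NumberTheory.EllipticCurves.TateModule.proj_smul_of_distribMulAction, hm, Literature.NumberTheory.EllipticCurves.TateModule.proj_intCast_smul]
  -- the cyclic `2`-power quotients
  have hquot : ∀ v : W.tateModule 2, Literature.NumberTheory.EllipticCurves.TateModule.proj 2 1 v ≠ 0 →
      (∀ (n : ℕ) (τ : Field.absoluteGaloisGroup K),
        τ • Literature.NumberTheory.EllipticCurves.TateModule.proj 2 n v ∈ AddSubgroup.zmultiples (Literature.NumberTheory.EllipticCurves.TateModule.proj 2 n v)) →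
      ∀ n : ℕ, ∃ (B : WeierstrassCurve K) (_ : B.IsElliptic) (g : Isogeny W B) (f : Isogeny B W),
        (∀ P, g P = 0 ↔ P ∈ AddSubgroup.zmultiples (Literature.NumberTheory.EllipticCurves.TateModule.proj 2 n v)) ∧
          (∀ P, f (g P) = 2 ^ n • P) ∧ ∀ Q, g (f Q) = 2 ^ n • Q := by
    intro v hv hstab n
    have horder : addOrderOf (Literature.NumberTheory.EllipticCurves.TateModule.proj 2 n v) = 2 ^ n := by
      rw [← Nat.card_zmultiples]
      exact card_zmultiples_proj 2 hv n
    exact exists_isogeny_ker_eq_zmultiples_of_addOrderOf_eq_two_pow h2 hσ n W _ horder (hstab n σ)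
  obtain ⟨φ, ψ, hne⟩ := exists_isogeny_comp_ne_comp_of_smul_eq 2 h2' hσ hπc hquot
  exact ⟨⟨φ.toAddMonoidHom, φ.toAddMonoidHom_mem_endRing⟩,
    ⟨ψ.toAddMonoidHom, ψ.toAddMonoidHom_mem_endRing⟩, fun h ↦ hne (congrArg Subtype.val h)⟩

/-! ## Part 2. The central case in every characteristic, the discharge, and the `Hom` form -/

variable (W)

/-- **The central case of Tate's theorem: `End_k(E)` is not commutative.** For `E` elliptic over
a finite field `k`, `ℓ ≠ char k`, and the arithmetic Frobenius `σ_q` acting on `T_ℓ E` as an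
`ℓ`-adic scalar, `End_k(E)` contains two elements which do not commute: `σ_q` acts on `E(k̄)` as
an integer `m` (`exists_int_frobenius_smul_eq_zsmul`), and then
`exists_endRing_mul_ne_mul_of_frobenius_smul_eq_zsmul` (odd characteristic, `2`-isogeny chains
and Tate's §2 at the prime `2`) or `…_of_two_eq_zero` (characteristic `2`, automorphisms of the
`j = 0` curve) applies. (Waterhouse, Ann. Sci. ÉNS 2 (1969), Thm. 4.1 (2): these are the
supersingular curves with all endomorphisms defined over `k`, `End_k(E) ⊗ ℚ` the quaternion
algebra ramified at `p` and `∞`.) [cite: Tate1966Endomorphisms, Main Theorem and §2] -/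
theorem exists_endRing_mul_ne_mul_of_smul_eq [Finite K] [W.IsElliptic] (hℓ : (ℓ : K) ≠ 0)
    {σ : Field.absoluteGaloisGroup K} (hσ : ∀ x : AlgebraicClosure K, σ • x = x ^ Nat.card K)
    (hπ : ∃ c : ℤ_[ℓ], ∀ x : W.tateModule ℓ, σ • x = c • x) :
    ∃ a b : W.endRing, a * b ≠ b * a := by
  obtain ⟨c, hc⟩ := hπ
  obtain ⟨m, hm⟩ := exists_int_frobenius_smul_eq_zsmul W ℓ hℓ hσ hc
  by_cases h2 : (2 : K) = 0
  · exact exists_endRing_mul_ne_mul_of_frobenius_smul_eq_zsmul_of_two_eq_zero W h2 hσ hm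
  · exact exists_endRing_mul_ne_mul_of_frobenius_smul_eq_zsmul W h2 hσ hm

/-- **Tate's theorem, `ℚ_ℓ`-form, in the central case**: for `E` elliptic over a finite field `k`,
`ℓ ≠ char k`, and `σ_q` an `ℓ`-adic scalar on `T_ℓ E`, every `ℤ_ℓ`-linear endomorphism `g` of
`T_ℓ E` has `ℓ ^ n • g ∈ ℤ_ℓ · End_k(E)` for some `n` (`End_k(E)` is not commutative,
`exists_endRing_mul_ne_mul_of_smul_eq`, so `ℚ_ℓ · End_k(E) = End(V_ℓ E)`,
`exists_pow_smul_mem_span_range_tateEndRingHom_of_mul_ne`). Tate, Invent. Math. 2 (1966), Main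
Theorem `⊗ ℚ_ℓ` and §2. [cite: Tate1966Endomorphisms, Main Theorem and §2] -/
theorem exists_pow_smul_mem_span_range_tateEndRingHom_of_smul_eq [Finite K] [W.IsElliptic]
    (hℓ : (ℓ : K) ≠ 0) {σ : Field.absoluteGaloisGroup K}
    (hσ : ∀ x : AlgebraicClosure K, σ • x = x ^ Nat.card K)
    (hπ : ∃ c : ℤ_[ℓ], ∀ x : W.tateModule ℓ, σ • x = c • x)
    (g : Module.End ℤ_[ℓ] (W.tateModule ℓ)) :
    ∃ n : ℕ, (ℓ : ℤ_[ℓ]) ^ n • g ∈ Submodule.span ℤ_[ℓ] (Set.range (tateEndRingHom W ℓ)) := by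
  obtain ⟨a, b, hab⟩ := exists_endRing_mul_ne_mul_of_smul_eq W ℓ hℓ hσ hπ
  exact exists_pow_smul_mem_span_range_tateEndRingHom_of_mul_ne W ℓ hℓ hab g

/-- **Tate's isogeny theorem, `End` form, for elliptic curves over finite fields** — discharge of
the named fact `Literature.Hodge.mem_span_range_tateEndRingHom_iff_of_finite W ℓ`: for `E` elliptic over
a finite field `k` and a prime `ℓ` with `ℓ ≠ 0` in `k`, a `ℤ_ℓ`-linear endomorphism `g` of `T_ℓ E`
lies in the `ℤ_ℓ`-span of the image of `End_k(E)` if and only if `g (σ x) = σ (g x)` for all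
`σ ∈ Γ_k`, `x ∈ T_ℓ E`. The tree's `mem_span_range_tateEndRingHom_iff_of_finite_of_central_case`
(non-central case proved there) fed with the central case
`exists_pow_smul_mem_span_range_tateEndRingHom_of_smul_eq`. Tate, Invent. Math. 2 (1966), Main
Theorem; Silverman, *AEC*, Thm. III.7.7(a). [cite: Tate1966Endomorphisms, Main Theorem] -/
theorem mem_span_range_tateEndRingHom_iff_of_finite_holds :
    mem_span_range_tateEndRingHom_iff_of_finite W ℓ :=
  mem_span_range_tateEndRingHom_iff_of_finite_of_central_case W ℓ fun hℓ _ hσ hπ g _ ↦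
    exists_pow_smul_mem_span_range_tateEndRingHom_of_smul_eq W ℓ hℓ hσ hπ g

/-! ## The `Hom` form for `E' = E` -/

/-- For an elliptic curve, the `ℤ_ℓ`-span of the image of `End_K(E)` in `End(T_ℓ E)` is the
`ℤ_ℓ`-span of the Tate-module maps of the isogenies `E → E` over `K` (an element of `End_K(E)` is
`0` or an isogeny, Silverman, *AEC*, III.§4; the tree's `eq_zero_or_exists_isogeny_of_mem_endRing`
with `mem_geomEndRing_iff_holds`; the other inclusion is
`span_range_tateModule_map_le_span_range_tateEndRingHom`). [folklore] -/
theorem span_range_tateEndRingHom_eq_span_range_tateModule_map [W.IsElliptic] :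
    Submodule.span ℤ_[ℓ] (Set.range (tateEndRingHom W ℓ)) =
      Submodule.span ℤ_[ℓ] (Set.range fun φ : Isogeny W W ↦ Literature.NumberTheory.EllipticCurves.TateModule.map ℓ φ.toAddMonoidHom) := by
  refine le_antisymm (Submodule.span_le.mpr ?_)
    (span_range_tateModule_map_le_span_range_tateEndRingHom W ℓ)
  rintro _ ⟨a, rfl⟩
  rcases eq_zero_or_exists_isogeny_of_mem_endRing W (mem_geomEndRing_iff_holds W) a.2 with
    h0 | ⟨χ, hχ⟩
  · have ha : tateEndRingHom W ℓ a = 0 := by rw [show a = 0 from Subtype.ext h0, map_zero]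
    rw [SetLike.mem_coe, ha]
    exact Submodule.zero_mem _
  · exact Submodule.subset_span ⟨χ, congrArg (Literature.NumberTheory.EllipticCurves.TateModule.map ℓ) hχ⟩

/-- **Tate's theorem, `Hom` form with `E' = E`, for elliptic curves over finite fields**: the
instance `W' = W` of the named fact `mem_span_range_tateModule_map_of_equivariant_of_finite` —
every `Γ_k`-equivariant `ℤ_ℓ`-linear `f : T_ℓ E → T_ℓ E` lies in the `ℤ_ℓ`-span of the `T_ℓ φ`,
`φ : E → E` an isogeny over `k` — from `mem_span_range_tateEndRingHom_iff_of_finite_holds`.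
(The general `Hom` form for two curves needs in addition Tate's isogeny theorem,
`isIsogenous_iff_exists_tateModule_hom_ne_zero_of_finite`.) Tate, Invent. Math. 2 (1966), Main
Theorem; Silverman, *AEC*, Thm. III.7.7(a). [cite: Tate1966Endomorphisms, Main Theorem] -/
theorem mem_span_range_tateModule_map_of_equivariant_of_finite_self :
    mem_span_range_tateModule_map_of_equivariant_of_finite W W ℓ := by
  intro _ _ _ hℓ f hf
  rw [← span_range_tateEndRingHom_eq_span_range_tateModule_map W ℓ]
  exact (mem_span_range_tateEndRingHom_iff_of_finite_holds W ℓ hℓ f).mpr hf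

/-! ## The `Hom` form for isogenous curves, and from the isogeny theorem alone -/

variable {W} in
/-- **Tate's theorem for `End_k(E)`, rational form, unconditionally**: every `Γ_k`-equivariant
`ℤ_ℓ`-linear endomorphism `f` of `T_ℓ E` (indeed `f` itself, `n = 0`) lies in the `ℤ_ℓ`-span of the
`T_ℓ φ`, `φ : E → E` an isogeny over `k` (`mem_span_range_tateEndRingHom_iff_of_finite_holds` with
`span_range_tateEndRingHom_eq_span_range_tateModule_map`; the tree's
`exists_pow_smul_mem_span_tateModule_map_of_equivariant_end` without its hypothesis `hquot`).
Tate, Invent. Math. 2 (1966), Main Theorem. [cite: Tate1966Endomorphisms, Main Theorem] -/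
theorem exists_pow_smul_mem_span_tateModule_map_of_equivariant_end_unconditional [Finite K]
    [W.IsElliptic] (hℓ : (ℓ : K) ≠ 0) (f : W.tateModule ℓ →ₗ[ℤ_[ℓ]] W.tateModule ℓ)
    (hf : ∀ (σ : Field.absoluteGaloisGroup K) (x : W.tateModule ℓ), f (σ • x) = σ • f x) :
    ∃ n : ℕ, (ℓ : ℤ_[ℓ]) ^ n • f ∈ Submodule.span ℤ_[ℓ]
      (Set.range fun φ : Isogeny W W ↦ Literature.NumberTheory.EllipticCurves.TateModule.map ℓ φ.toAddMonoidHom) := by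
  refine ⟨0, ?_⟩
  rw [pow_zero, one_smul, ← span_range_tateEndRingHom_eq_span_range_tateModule_map W ℓ]
  exact (mem_span_range_tateEndRingHom_iff_of_finite_holds W ℓ hℓ f).mpr hf

variable {W} {W' : WeierstrassCurve K}

/-- **Tate's theorem for `Hom_k(E, E')` of two isogenous curves, rational form, unconditionally**
(the tree's `exists_pow_smul_mem_span_tateModule_map_of_equivariant_of_isogeny` without `hquot`;
proof copied, the `End` case being `…_end_unconditional`): for an isogeny `φ₀ : E → E'` over a
finite field `k`, `ℓ ≠ char k`, every `ℤ_ℓ`-linear `Γ_k`-equivariant `f : T_ℓ E → T_ℓ E'` has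
`ℓ ^ n • f` in the `ℤ_ℓ`-span of the `T_ℓ φ`, `φ : E → E'` an isogeny over `k` (`d • f =
T_ℓ φ₀ ∘ (v ∘ f)` for the equivariant quasi-inverse `v` of `T_ℓ φ₀`). Tate, Invent. Math. 2
(1966), Main Theorem; Silverman, *AEC*, III.7.7(a). [cite: Tate1966Endomorphisms, Main Theorem] -/
theorem exists_pow_smul_mem_span_tateModule_map_of_equivariant_of_isogeny_unconditional [Finite K]
    [W.IsElliptic] [W'.IsElliptic] (hℓ : (ℓ : K) ≠ 0)
    (φ₀ : Isogeny W W') (f : W.tateModule ℓ →ₗ[ℤ_[ℓ]] W'.tateModule ℓ)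
    (hf : ∀ (σ : Field.absoluteGaloisGroup K) (x : W.tateModule ℓ), f (σ • x) = σ • f x) :
    ∃ n : ℕ, (ℓ : ℤ_[ℓ]) ^ n • f ∈ Submodule.span ℤ_[ℓ]
      (Set.range fun φ : Isogeny W W' ↦ Literature.NumberTheory.EllipticCurves.TateModule.map ℓ φ.toAddMonoidHom) := by
  -- the equivariant quasi-inverse of `T_ℓ φ₀`
  obtain ⟨d, v, hd, hgv, -, hveq⟩ := exists_equivariant_quasiInverse ℓ hℓ φ₀
  -- `v ∘ f ∈ End_Γ(T_ℓ E)`: the `End` case applies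
  have hvf : ∀ (σ : Field.absoluteGaloisGroup K) (x : W.tateModule ℓ),
      (v ∘ₗ f) (σ • x) = σ • (v ∘ₗ f) x := fun σ x ↦ by
    rw [LinearMap.comp_apply, LinearMap.comp_apply, hf, hveq]
  obtain ⟨n, hn⟩ :=
    exists_pow_smul_mem_span_tateModule_map_of_equivariant_end_unconditional ℓ hℓ (v ∘ₗ f) hvf
  -- push forward along `T_ℓ φ₀ ∘ -`
  set L : (W.tateModule ℓ →ₗ[ℤ_[ℓ]] W.tateModule ℓ) →ₗ[ℤ_[ℓ]]
      W.tateModule ℓ →ₗ[ℤ_[ℓ]] W'.tateModule ℓ :=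
    LinearMap.llcomp ℤ_[ℓ] _ _ _ (Literature.NumberTheory.EllipticCurves.TateModule.map ℓ φ₀.toAddMonoidHom) with hL
  have hLspan : (Submodule.span ℤ_[ℓ]
      (Set.range fun ψ : Isogeny W W ↦ Literature.NumberTheory.EllipticCurves.TateModule.map ℓ ψ.toAddMonoidHom)).map L ≤
      Submodule.span ℤ_[ℓ] (Set.range fun χ : Isogeny W W' ↦ Literature.NumberTheory.EllipticCurves.TateModule.map ℓ χ.toAddMonoidHom) := by
    rw [Submodule.map_span, Submodule.span_le]
    rintro _ ⟨_, ⟨ψ, rfl⟩, rfl⟩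
    refine Submodule.subset_span ⟨φ₀.comp ψ, ?_⟩
    rw [hL, LinearMap.llcomp_apply']
    exact Literature.NumberTheory.EllipticCurves.TateModule.map_comp _ _
  have h1 := hLspan (Submodule.mem_map_of_mem hn)
  have h2 : L ((ℓ : ℤ_[ℓ]) ^ n • (v ∘ₗ f)) = ((ℓ : ℤ_[ℓ]) ^ n * d) • f := by
    rw [map_smul, hL, LinearMap.llcomp_apply', ← LinearMap.comp_assoc, hgv, LinearMap.smul_comp,
      LinearMap.id_comp, smul_smul]
  rw [h2] at h1
  obtain ⟨m, u, hu⟩ : ∃ (m : ℕ) (u : ℤ_[ℓ]ˣ), d = u * (ℓ : ℤ_[ℓ]) ^ m :=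
    ⟨_, _, PadicInt.unitCoeff_spec hd⟩
  refine ⟨n + m, ?_⟩
  have h3 : (ℓ : ℤ_[ℓ]) ^ (n + m) • f =
      ((u⁻¹ : ℤ_[ℓ]ˣ) : ℤ_[ℓ]) • (((ℓ : ℤ_[ℓ]) ^ n * d) • f) := by
    rw [hu, smul_smul, pow_add, mul_left_comm ((ℓ : ℤ_[ℓ]) ^ n) (u : ℤ_[ℓ]), ← mul_assoc,
      ← mul_assoc, Units.inv_mul, one_mul]
  rw [h3]
  exact Submodule.smul_mem _ _ h1

variable (W W') in
/-- **Tate's theorem for two isogenous elliptic curves over a finite field** (proved): if `E, E'`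
are isogenous over `k`, the named fact `mem_span_range_tateModule_map_of_equivariant_of_finite W W' ℓ`
holds — every `Γ_k`-equivariant `ℤ_ℓ`-linear `T_ℓ E → T_ℓ E'` is in the `ℤ_ℓ`-span of the `T_ℓ φ`
(rational form `…_of_isogeny_unconditional`, then Tate's Lemma 1 with Cor. III.4.11 over `k`,
the tree's `mem_span_tateModule_map_of_pow_smul_mem` and
`Isogeny.exists_eq_comp_nsmul_of_geomTorsion_le_ker_holds`). Tate, Invent. Math. 2 (1966),
Main Theorem; Silverman, *AEC*, III.7.7(a). [cite: Tate1966Endomorphisms, Main Theorem] -/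
theorem mem_span_range_tateModule_map_of_equivariant_of_finite_of_isIsogenous
    (hiso : W.IsIsogenous W') : mem_span_range_tateModule_map_of_equivariant_of_finite W W' ℓ := by
  intro _ _ _ hℓ f hf
  obtain ⟨φ₀⟩ := hiso
  obtain ⟨n, hn⟩ :=
    exists_pow_smul_mem_span_tateModule_map_of_equivariant_of_isogeny_unconditional ℓ hℓ φ₀ f hf
  exact mem_span_tateModule_map_of_pow_smul_mem ℓ hℓ
    (Isogeny.exists_eq_comp_nsmul_of_geomTorsion_le_ker_holds W W') hn

variable (W W') in
/-- **Tate's theorem for elliptic curves over a finite field, `Hom` form, from the isogeny theorem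
alone**: the named fact `mem_span_range_tateModule_map_of_equivariant_of_finite W W' ℓ` (Tate,
Invent. Math. 2 (1966), Main Theorem: `Hom_k(E, E') ⊗ ℤ_ℓ → Hom_Γ(T_ℓ E, T_ℓ E')` is onto) follows
from Tate's Theorem 1(b) for `(E, E')` at `ℓ` (`hisog`, the named fact
`isIsogenous_of_finite_iff_exists_tateModule_hom_ne_zero W W' ℓ`), used only to produce one isogeny
`E → E'` when a non-zero equivariant map exists; the quotient isogenies and Cor. III.4.11 of the
tree's `mem_span_range_tateModule_map_of_equivariant_of_finite_of_quot` are now theorems.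
[cite: Tate1966Endomorphisms, Main Theorem and Theorem 1(b)] -/
theorem mem_span_range_tateModule_map_of_equivariant_of_finite_of_isogenous_fact
    (hisog : isIsogenous_of_finite_iff_exists_tateModule_hom_ne_zero W W' ℓ) :
    mem_span_range_tateModule_map_of_equivariant_of_finite W W' ℓ := by
  intro _ _ _ hℓ f hf
  by_cases hf0 : f = 0
  · rw [hf0]
    exact Submodule.zero_mem _
  exact mem_span_range_tateModule_map_of_equivariant_of_finite_of_isIsogenous (W := W) (W' := W')
    ℓ ((hisog hℓ).mpr ⟨f, hf0, hf⟩) hℓ f hf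

end Literature.AlgebraicGeometry.Motives
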